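/- Copyright: the b2b-balaban cell (near-miss cell 7), T⁴-continuum fan-out; row NE7b OWNER lineage `t4-ne7b-p1`
(gen 60) — «G-56-1 ON THE COUNT SIDE: HULL-JOINS ARE BOOKED», part 1 of 2 (kernel item of RULING R-OWNER-60-3).
Released under the licence of the surrounding project. -/
import Summits.QuantumFields.BalabanUV.T4Continuum.Support.HistoryReadinessChainRealisePrint

/-!
# Bounding-box transport along the flow, and the join lifetime bounds for partners whose HULLS touch (row NE7b,
R-OWNER-60-3, part 1 of 2; part 2 = `HistoryRealiseHull`)

Summits-side support leaf of the T⁴-continuum cell (rung (B)+1 on a FINITE torus only; NOT infinite volume, NOT the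
mass gap, NOT the Clay statement; NOT a proof of the spine estimate NE7b — the cell's OWN estimate, NOT PRINTED, NOT
PROVED).  [folklore] finite combinatorics in the ℤᵈ INDEX MODEL over the Literature typings `B13ScaleTransfer`
(`coarse`, `closureIdx`, `block`, `collar`), `B14BoxFix` (`bbox`, `ibox`, `FitsIn`), `B16SProfile` (`Sop`, `Siter`),
`B16StoppingRule` (`CondI`), `B16MergeHorizon`, row S1b's `HistoryWindows` (`stopAt_join`) and the owner's g60 chain-clock
files (`stopAtC_join'`); no `[cite:]` tag, no `def` at all, zero `sorry`.  [III] = [Balaban1988Convergent] p. 251 ∕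
p. 269 and B16 = [Balaban1989LargeFieldII] p. 387 are manuscripts UNDER AUDIT and appear only as LOCATORS.

WHY (the located rider G-56-1 «NO HULL IN THE PROCESS», WALL §3 (h); memo `g59/D5-FORK-READ.md` §7).  Print replaces
every (i)-small component by its smallest rectangular parallelepiped at every step ([III] p. 269 l. 8–11, p. 251 «the
smallest rectangular parallelepiped containing» — `B14BoxFix.bbox`); the cell's process keeps unions of images.  Along a
single line this changes nothing observable by condition (i) (a set fits in a cube of `100` iff its bounding box does —
`B14BoxFix.FitsIn.bbox`), but CONTACTS change: two hulls may touch while the raw images do not, so print can JOIN two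
lines at a scale at which the tree does not (g59 §7: «print first by δ ≤ 2∕5 levels»).  A realisation predicate
faithful to print therefore admits joins whose partners touch only THROUGH THEIR HULLS.  THIS FILE supplies what the
lifetime theorem needs for such joins: (§1) the bounding box is TRANSPORTED by the flow — if `S` lies in the bounding
box of `X` then `S_q(S)` lies in the bounding box of `S_q(X)` (coarsening is coordinatewise monotone, a layer is a
coordinatewise ±1), hence along `S^{·}`; and a set enlarged inside its own bounding box keeps condition (i); (§2) so a
hull-contact `a ∈ bbox X`, `c ∈ bbox Y`, `Touch a c` is a RAW contact of the enlarged partners `X ∪ {a}`, `Y ∪ {c}`, which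
satisfy condition (i) at exactly the scales `X`, `Y` do — and the landed join bounds (`HistoryWindows.stopAt_join` for
the tree clock, `HistoryReadinessChainRealisePrint.stopAtC_join'` for the chain clock) apply VERBATIM, the conclusion
descending to `X ∪ Y ⊆ (X ∪ {a}) ∪ (Y ∪ {c})`.  Same constants: `max K₁ K₂ + 13 + N`, `n₁ = 13`.

WHAT.  §1 `coarse_mem_bbox_closureIdx`, `block_subset_bbox_collar`, `collar_bbox`, `iterate_collar_bbox`, `Sop_bbox`,
`Siter_bbox`, `condI_of_subset_bbox`, `condI_union_of_mem_bbox`, `condI_Siter_union_singleton`, `condI_anti`,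
`stopAt_Siter_anti`, `stopAtC_Siter_anti`, `union_subset_union_insert`.  §2 **`stopAt_join_hull`** (tree clock, partners' (i) at own indices
`K₁, K₂ ≥ 1`), **`stopAt_union_hull`** (tree clock, one partner (i)-small AT the join scale), **`stopAtC_join_hull`**
(chain clock, ALL `K₁, K₂ ≥ 0`).

HONEST SCOPE.  Index-model geometry on hypothesis shapes; the hull-touch clause ADMITS MORE than print (print hulls
only (i)-small components; here any partner may be met through its hull) — harmless for a booking theorem; nothing of
Bałaban's asserted, instantiated or discharged; the process of record NOT edited; census NONE; R∕T rows by count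
UNCHANGED.  NE7b NOT PRINTED ∕ NOT PROVED; spine 0∕9.  HONEST DEPENDENCY (cell): continuum YM on T⁴ ⇐ BetaPertH ∧ nine
spine estimates (0/9 proved); BetaPertH ⇐ (D1) ∧ (D4) ∧ CAP+tail; G-an2-4 gates asym, D1 and NE2/3/4.  This file changes
none of it.
-/

open Finset
open Literature.MathematicalPhysics.QuantumFieldTheory.Balaban1983to89
open Literature.MathematicalPhysics.QuantumFieldTheory.Balaban1983to89.B13ScaleTransfer
open Literature.MathematicalPhysics.QuantumFieldTheory.Balaban1983to89.B16SProfile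
open Literature.MathematicalPhysics.QuantumFieldTheory.Balaban1983to89.B16StoppingRule
open Literature.MathematicalPhysics.QuantumFieldTheory.Balaban1983to89.B16MergeGeometry
open Literature.MathematicalPhysics.QuantumFieldTheory.Balaban1983to89.B16MergeHorizon
open Literature.MathematicalPhysics.QuantumFieldTheory.Balaban1983to89.B14BoxFix (bbox ibox FitsIn)
open Summit.QuantumFields.BalabanUV.T4Continuum.HistoryWindows
open Summit.QuantumFields.BalabanUV.T4Continuum.HistoryReadinessChainScale
open Summit.QuantumFields.BalabanUV.T4Continuum.HistoryReadinessChainRealisePrint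

namespace Summit.QuantumFields.BalabanUV.T4Continuum.HistoryHullTransport

noncomputable section

variable {d : ℕ}

/-! ## §1 The bounding box is transported by the flow -/

/-- coarsening is coordinatewise monotone: a point of the bounding box of `X` coarsens INTO the bounding box of the
coarsened `X`. [folklore] -/
theorem coarse_mem_bbox_closureIdx {q : ℕ} (hq : 0 < q) {X : Finset (Pt d)} {a : Pt d}
    (ha : a ∈ bbox (↑X : Set (Pt d))) : coarse q a ∈ bbox (↑(closureIdx q X) : Set (Pt d)) := by
  intro i
  obtain ⟨⟨x, hx, hxa⟩, ⟨y, hy, hay⟩⟩ := ha i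
  have hq' : (0 : ℤ) < (q : ℤ) := by exact_mod_cast hq
  refine ⟨⟨coarse q x, ?_, ?_⟩, ⟨coarse q y, ?_, ?_⟩⟩
  · exact Finset.mem_coe.2 (Finset.mem_image_of_mem _ (Finset.mem_coe.1 hx))
  · exact Int.ediv_le_ediv hq' hxa
  · exact Finset.mem_coe.2 (Finset.mem_image_of_mem _ (Finset.mem_coe.1 hy))
  · exact Int.ediv_le_ediv hq' hay

/-- a layer is a coordinatewise `±1`: the block around a point of the bounding box of `X` lies in the bounding box of
the collared `X`. [folklore] -/
theorem block_subset_bbox_collar {X : Finset (Pt d)} {a : Pt d} (ha : a ∈ bbox (↑X : Set (Pt d))) :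
    ∀ y ∈ block a, y ∈ bbox (↑(collar X) : Set (Pt d)) := by
  intro y hy i
  have hyi := (mem_block.1 hy) i
  obtain ⟨⟨x, hx, hxa⟩, ⟨z, hz, haz⟩⟩ := ha i
  refine ⟨⟨fun j => x j - 1, ?_, by show x i - 1 ≤ y i; omega⟩, ⟨fun j => z j + 1, ?_, by show y i ≤ z i + 1; omega⟩⟩
  · exact Finset.mem_coe.2 (mem_collar.2 ⟨x, Finset.mem_coe.1 hx, mem_block.2 fun j => ⟨le_rfl, by omega⟩⟩)
  · exact Finset.mem_coe.2 (mem_collar.2 ⟨z, Finset.mem_coe.1 hz, mem_block.2 fun j => ⟨by omega, le_rfl⟩⟩)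

/-- one layer transports the bounding box. [folklore] -/
theorem collar_bbox {S X : Finset (Pt d)} (h : ∀ s ∈ S, s ∈ bbox (↑X : Set (Pt d))) :
    ∀ y ∈ collar S, y ∈ bbox (↑(collar X) : Set (Pt d)) := by
  intro y hy
  obtain ⟨s, hs, hys⟩ := mem_collar.1 hy
  exact block_subset_bbox_collar (h s hs) y hys

/-- `n` layers transport the bounding box. [folklore] -/
theorem iterate_collar_bbox (n : ℕ) : ∀ {S X : Finset (Pt d)}, (∀ s ∈ S, s ∈ bbox (↑X : Set (Pt d))) →
    ∀ y ∈ collar^[n] S, y ∈ bbox (↑(collar^[n] X) : Set (Pt d)) := by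
  induction n with
  | zero => intro S X h y hy; exact h y hy
  | succ n ih =>
      intro S X h y hy
      rw [Function.iterate_succ_apply'] at hy ⊢
      exact collar_bbox (ih h) y hy

/-- **ONE `S`-STEP TRANSPORTS THE BOUNDING BOX**: if `S ⊆ bbox X` then `S_q(S) ⊆ bbox (S_q(X))` (`q ≥ 1`). [folklore] -/
theorem Sop_bbox {q : ℕ} (hq : 0 < q) {S X : Finset (Pt d)} (h : ∀ s ∈ S, s ∈ bbox (↑X : Set (Pt d))) :
    ∀ y ∈ Sop q S, y ∈ bbox (↑(Sop q X) : Set (Pt d)) := by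
  refine iterate_collar_bbox 10 (S := closureIdx q S) (X := closureIdx q X) ?_
  intro s hs
  obtain ⟨a, ha, rfl⟩ := Finset.mem_image.1 hs
  exact coarse_mem_bbox_closureIdx hq (h a ha)

/-- **THE FLOW TRANSPORTS THE BOUNDING BOX**: if `S ⊆ bbox X` then `S^{t}(S) ⊆ bbox (S^{t}(X))` along any ratio
sequence of positive ratios. [folklore] -/
theorem Siter_bbox {q : ℕ → ℕ} (hq : ∀ l, 0 < q l) {S X : Finset (Pt d)} (h : ∀ s ∈ S, s ∈ bbox (↑X : Set (Pt d))) :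
    ∀ t, ∀ y ∈ Siter q t S, y ∈ bbox (↑(Siter q t X) : Set (Pt d))
  | 0 => h
  | t + 1 => by
      rw [Siter_succ, Siter_succ]
      exact Sop_bbox (hq t) (Siter_bbox hq h t)

/-- a set enlarged inside the bounding box of an (i)-small set is (i)-small (the bounding box lies in every box
containing the set, `B14BoxFix.bbox_subset_ibox`). [folklore] -/
theorem condI_of_subset_bbox {Nsz : ℕ} {X S : Finset (Pt d)} (hX : CondI Nsz X)
    (hS : ∀ s ∈ S, s ∈ (↑X : Set (Pt d)) ∨ s ∈ bbox (↑X : Set (Pt d))) : CondI Nsz S := by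
  obtain ⟨lo, hlo⟩ := hX
  refine ⟨lo, fun s hs => ?_⟩
  rcases hS s (Finset.mem_coe.1 hs) with h | h
  · exact hlo h
  · exact B14BoxFix.bbox_subset_ibox hlo h

/-- adjoining points of the bounding box keeps condition (i). [folklore] -/
theorem condI_union_of_mem_bbox {Nsz : ℕ} {X S : Finset (Pt d)} (hX : CondI Nsz X)
    (hS : ∀ s ∈ S, s ∈ bbox (↑X : Set (Pt d))) : CondI Nsz (X ∪ S) :=
  condI_of_subset_bbox hX fun s hs => by
    rcases Finset.mem_union.1 hs with h | h
    · exact Or.inl (Finset.mem_coe.2 h)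
    · exact Or.inr (hS s h)

/-- **ADJOINING A HULL POINT KEEPS CONDITION (i) ALONG THE FLOW**: if `a ∈ bbox X` and `S^{m}(X)` satisfies (i), so does
`S^{m}(X ∪ {a})`. [folklore] -/
theorem condI_Siter_union_singleton {q : ℕ → ℕ} (hq : ∀ l, 0 < q l) {Nsz : ℕ} {X : Finset (Pt d)} {a : Pt d}
    (ha : a ∈ bbox (↑X : Set (Pt d))) {m : ℕ} (hX : CondI Nsz (Siter q m X)) : CondI Nsz (Siter q m (X ∪ {a})) := by
  rw [Siter_union]
  exact condI_union_of_mem_bbox hX (Siter_bbox hq (S := {a}) (fun s hs => by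
    rw [Finset.mem_singleton] at hs; subst hs; exact ha) m)

/-- condition (i) passes to sub-domains (any size parameter). [folklore] -/
theorem condI_anti {Nsz : ℕ} {X X' : Finset (Pt d)} (h : X' ⊆ X) (hX : CondI Nsz X) : CondI Nsz X' := by
  obtain ⟨lo, hlo⟩ := hX
  exact ⟨lo, fun y hy => hlo (Finset.coe_subset.2 h hy)⟩

/-- the tree stopping property passes to sub-domains along the flow. [folklore] -/
theorem stopAt_Siter_anti {q : ℕ → ℕ} {Nsz N : ℕ} {Clean : ℕ → Prop} {X Y : Finset (Pt d)} (h : X ⊆ Y) {k : ℕ}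
    (hY : StopAt Nsz N Clean (fun l => Siter q l Y) k) : StopAt Nsz N Clean (fun l => Siter q l X) k := by
  obtain ⟨hk, hI, hN, hall⟩ := hY
  exact ⟨hk, condI_anti (Siter_subset_Siter q h k) hI, hN,
    fun l h1 h2 => ⟨(hall l h1 h2).1, condI_anti (Siter_subset_Siter q h l) (hall l h1 h2).2⟩⟩

/-- the chain stopping property passes to sub-domains along the flow. [folklore] -/
theorem stopAtC_Siter_anti {q : ℕ → ℕ} {Nsz N : ℕ} {Clean : ℕ → Prop} {X Y : Finset (Pt d)} (h : X ⊆ Y) {k : ℕ}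
    (hY : StopAtC Nsz N Clean (fun l => Siter q l Y) k) : StopAtC Nsz N Clean (fun l => Siter q l X) k :=
  ⟨stopAt_Siter_anti h hY.1, condI_anti (Siter_subset_Siter q h _) hY.2⟩

/-! ## §2 The join lifetime bounds for partners touching THROUGH THEIR HULLS -/

/-- the union of the partners lies in the union of the enlarged partners [folklore] -/
theorem union_subset_union_insert (X Y : Finset (Pt d)) (a c : Pt d) : X ∪ Y ⊆ (X ∪ {a}) ∪ (Y ∪ {c}) := by
  intro z hz
  rcases Finset.mem_union.1 hz with h | h
  · exact Finset.mem_union.2 (Or.inl (Finset.mem_union.2 (Or.inl h)))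
  · exact Finset.mem_union.2 (Or.inr (Finset.mem_union.2 (Or.inl h)))

/-- **TREE CLOCK, HULL CONTACT: THE JOIN STOPS WITHIN `max K₁ K₂ + 13 + N`.**  Two domains at the join scale whose
BOUNDING BOXES touch (`a ∈ bbox X`, `c ∈ bbox Y`, `Touch a c`), with condition (i) at own indices `K₁, K₂ ≥ 1` along the
common flow (`L ≥ 2`, drop control on the horizon `m′`); memory `N ≥ 1`, the steps after the join clean: the union has
the stopping property at some `1 ≤ k ≤ max K₁ K₂ + 13 + N` — `HistoryWindows.stopAt_join` on the enlarged partners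
`X ∪ {a}`, `Y ∪ {c}`. [folklore] -/
theorem stopAt_join_hull {L : ℕ} (hL : 2 ≤ L) {σ : ℕ → ℕ} {m' : ℕ} (hσ : DropCtl σ m')
    {X Y : Finset (Pt d)} {a c : Pt d} (ha : a ∈ bbox (↑X : Set (Pt d))) (hc : c ∈ bbox (↑Y : Set (Pt d)))
    (hac : Touch a c) {K₁ K₂ : ℕ} (hK₁ : 1 ≤ K₁) (hK₂ : 1 ≤ K₂)
    (hXI : CondI 100 (Siter (ratio L σ) K₁ X)) (hYI : CondI 100 (Siter (ratio L σ) K₂ Y))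
    {N : ℕ} (hN : 1 ≤ N) (Clean : ℕ → Prop) (hclean : ∀ l, 1 ≤ l → l ≤ m' → Clean l)
    (hm : max K₁ K₂ + 13 + N ≤ m') :
    ∃ k, 1 ≤ k ∧ k ≤ max K₁ K₂ + 13 + N ∧ StopAt 100 N Clean (fun l => Siter (ratio L σ) l (X ∪ Y)) k := by
  have hq : ∀ l, 0 < ratio L σ l := fun l => ratio_pos (by omega) σ l
  obtain ⟨k, hk1, hk, hstop⟩ := stopAt_join hL hσ (X := X ∪ {a}) (Y := Y ∪ {c})
    (Finset.mem_union_right _ (Finset.mem_singleton_self a)) (Finset.mem_union_right _ (Finset.mem_singleton_self c))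
    hac hK₁ hK₂ (condI_Siter_union_singleton hq ha hXI) (condI_Siter_union_singleton hq hc hYI) hN Clean hclean hm
  exact ⟨k, hk1, hk, stopAt_Siter_anti (union_subset_union_insert X Y a c) hstop⟩

/-- **TREE CLOCK, HULL CONTACT, ONE PARTNER SMALL AT THE JOIN SCALE** (print's `K₁ = 0` partner, [B16] p. 387): `X`
(i)-small AT the join scale, its bounding box touching the bounding box of `Y`, `Y` (i)-small at its index `s`: the
union has the stopping property at `max (s + 6) 14 + N − 1` — `B16MergeHorizon.stopAt_union` on the enlarged partners.
[folklore] -/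
theorem stopAt_union_hull {L : ℕ} (hL : 2 ≤ L) {σ : ℕ → ℕ} {m' : ℕ} (hσ : DropCtl σ m')
    {X Y : Finset (Pt d)} {a c : Pt d} (ha : a ∈ bbox (↑X : Set (Pt d))) (hc : c ∈ bbox (↑Y : Set (Pt d)))
    (hac : Touch a c) (hX0 : CondI 100 X) {s : ℕ} (hYI : CondI 100 (Siter (ratio L σ) s Y))
    {N : ℕ} (hN : 1 ≤ N) (Clean : ℕ → Prop) (hclean : ∀ l, 1 ≤ l → l ≤ m' → Clean l)
    (hm : max (s + 6) 14 + N - 1 ≤ m') :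
    StopAt 100 N Clean (fun l => Siter (ratio L σ) l (X ∪ Y)) (max (s + 6) 14 + N - 1) := by
  have hq : ∀ l, 0 < ratio L σ l := fun l => ratio_pos (by omega) σ l
  have hX0' : CondI 100 (X ∪ {a}) := by simpa using condI_Siter_union_singleton hq ha (m := 0) (by simpa using hX0)
  have hnear := near_of_condI_touch hX0' (Finset.mem_union_right _ (Finset.mem_singleton_self a)) hac
  have hst := stopAt_union hL hσ (X := X ∪ {a}) (Y := Y ∪ {c})
    (Finset.mem_union_right _ (Finset.mem_singleton_self c)) (D := 100) (by norm_num) (by norm_num) hnear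
    (condI_Siter_union_singleton hq hc hYI) hN Clean hclean hm
  exact stopAt_Siter_anti (union_subset_union_insert X Y a c) hst

/-- **CHAIN CLOCK, HULL CONTACT: THE JOIN CHAIN-STOPS WITHIN `max K₁ K₂ + 13 + N` FOR ALL `K₁, K₂ ≥ 0`** —
`HistoryReadinessChainRealisePrint.stopAtC_join'` on the enlarged partners `X ∪ {a}`, `Y ∪ {c}` (condition (i) of
each partner from ITS OWN INDEX MINUS ONE on, as a chain-stop supplies it). [folklore] -/
theorem stopAtC_join_hull {L : ℕ} (hL : 3 ≤ L) {σ : ℕ → ℕ} {m' : ℕ} (hσ : DropCtl σ m')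
    {X Y : Finset (Pt d)} {a c : Pt d} (ha : a ∈ bbox (↑X : Set (Pt d))) (hc : c ∈ bbox (↑Y : Set (Pt d)))
    (hac : Touch a c) {K₁ K₂ : ℕ}
    (hXI : ∀ m, K₁ - 1 ≤ m → CondI 100 (Siter (ratio L σ) m X))
    (hYI : ∀ m, K₂ - 1 ≤ m → CondI 100 (Siter (ratio L σ) m Y))
    {N : ℕ} (Clean : ℕ → Prop) (hclean : ∀ l, 1 ≤ l → l ≤ m' → Clean l)
    (hm : max K₁ K₂ + 13 + N ≤ m') :
    ∃ k, 1 ≤ k ∧ k ≤ max K₁ K₂ + 13 + N ∧ StopAtC 100 N Clean (fun l => Siter (ratio L σ) l (X ∪ Y)) k := by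
  have hq : ∀ l, 0 < ratio L σ l := fun l => ratio_pos (by omega) σ l
  obtain ⟨k, hk1, hk, hstop⟩ := stopAtC_join' hL hσ (X := X ∪ {a}) (Y := Y ∪ {c})
    (Finset.mem_union_right _ (Finset.mem_singleton_self a)) (Finset.mem_union_right _ (Finset.mem_singleton_self c))
    hac (K₁ := K₁) (K₂ := K₂) (fun m hm => condI_Siter_union_singleton hq ha (hXI m hm))
    (fun m hm => condI_Siter_union_singleton hq hc (hYI m hm)) Clean hclean hm
  exact ⟨k, hk1, hk, stopAtC_Siter_anti (union_subset_union_insert X Y a c) hstop⟩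

/-! ## §3 Adequacy: print's «hull at every step» process stays inside the hull of the raw image (X-read
C-ne7bleaf03g52-2, INFO-1; leaf-03 g52 at the owner's disposal — appended only on his word)

Print applies the hull rule at EVERY step ([III] p. 269 l. 8–11: replace the component by the smallest rectangular
parallelepiped containing it, then act with the next operation).  ANY such sequence — start inside `bbox X`, and at
each step choose any finite set inside the hull of the `S`-image of the previous choice (the full lattice box included)
— stays inside the hull of the RAW image `S^{t}(X)` (§1's `Sop_bbox` + `B14BoxFix.bbox_mono` + transitivity of
`bbox`).  Hence a contact between two hulled processes at a step IS a hull contact of the raw images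
«∃ a ∈ bbox (S^{t} X), ∃ c ∈ bbox (S^{t} Y), Touch a c» — the join clause of part 2 (`HistoryRealiseHull`) ADMITS every
join print's rule makes: the superset direction a booking theorem needs, as a theorem of the file.  [folklore]
ℤᵈ box geometry on hypothesis shapes; nothing of Bałaban's asserted; census NONE; NE7b NOT PRINTED ∕ NOT PROVED. -/

/-- the hull of a subset of a hull lies in that hull (transitivity of `B14BoxFix.bbox`). [folklore] -/
theorem bbox_bbox_subset (K : Set (Pt d)) : bbox (bbox K) ⊆ bbox K := by
  intro c hc i
  obtain ⟨⟨a, ha, hac⟩, ⟨b, hb, hcb⟩⟩ := hc i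
  obtain ⟨⟨a', ha', haa⟩, -⟩ := ha i
  obtain ⟨-, ⟨b', hb', hbb⟩⟩ := hb i
  exact ⟨⟨a', ha', haa.trans hac⟩, ⟨b', hb', hcb.trans hbb⟩⟩

/-- **ITERATED-HULL DOMINATION**: any sequence of finite sets starting inside `bbox X` and chosen at each step inside
the hull of the `S`-image of the previous one stays inside the hull of the raw image `S^{t}(X)`. [folklore] -/
theorem iterHull_subset_bbox_Siter {q : ℕ → ℕ} (hq : ∀ l, 0 < q l) {X : Finset (Pt d)} (P : ℕ → Finset (Pt d))
    (h0 : ∀ p ∈ P 0, p ∈ bbox (↑X : Set (Pt d)))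
    (hstep : ∀ t, ∀ p ∈ P (t + 1), p ∈ bbox (↑(Sop (q t) (P t)) : Set (Pt d))) :
    ∀ t, ∀ p ∈ P t, p ∈ bbox (↑(Siter q t X) : Set (Pt d))
  | 0 => by simpa using h0
  | t + 1 => by
      intro p hp
      have ih := iterHull_subset_bbox_Siter hq P h0 hstep t
      have h1 : (↑(Sop (q t) (P t)) : Set (Pt d)) ⊆ bbox (↑(Sop (q t) (Siter q t X)) : Set (Pt d)) :=
        fun y hy => Sop_bbox (hq t) ih y (Finset.mem_coe.1 hy)
      rw [Siter_succ]
      exact bbox_bbox_subset _ (B14BoxFix.bbox_mono h1 (hstep t p hp))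

/-- **A CONTACT BETWEEN TWO HULLED PROCESSES IS A HULL CONTACT OF THE RAW IMAGES** (part 2's join clause admits every
join print's hull rule makes). [folklore] -/
theorem hullContact_of_iterHull {q : ℕ → ℕ} (hq : ∀ l, 0 < q l) {X Y : Finset (Pt d)} (P Q : ℕ → Finset (Pt d))
    (hP0 : ∀ p ∈ P 0, p ∈ bbox (↑X : Set (Pt d)))
    (hPs : ∀ t, ∀ p ∈ P (t + 1), p ∈ bbox (↑(Sop (q t) (P t)) : Set (Pt d)))
    (hQ0 : ∀ p ∈ Q 0, p ∈ bbox (↑Y : Set (Pt d)))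
    (hQs : ∀ t, ∀ p ∈ Q (t + 1), p ∈ bbox (↑(Sop (q t) (Q t)) : Set (Pt d)))
    {t : ℕ} {a c : Pt d} (ha : a ∈ P t) (hc : c ∈ Q t) (hac : Touch a c) :
    ∃ a ∈ bbox (↑(Siter q t X) : Set (Pt d)), ∃ c ∈ bbox (↑(Siter q t Y) : Set (Pt d)), Touch a c :=
  ⟨a, iterHull_subset_bbox_Siter hq P hP0 hPs t a ha, c, iterHull_subset_bbox_Siter hq Q hQ0 hQs t c hc, hac⟩

end

end Summit.QuantumFields.BalabanUV.T4Continuum.HistoryHullTransport
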